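import Literature.NumberTheory.ConnesConsani2021.ArchKernelS8TruncationBounds
import Literature.NumberTheory.ConnesConsani2021.ArchKernelModesIdentified
import Literature.NumberTheory.ConnesConsani2021.ArchKernelTier2CombineSound
import Literature.NumberTheory.ConnesConsani2021.ArchKernelTier2S8Sound
import HarnessLib

/-!
# Connes–Consani 2021 §5–§6, the (E-a) kernel certificate — the S₈ read-back hypothesis H8E DISCHARGED
# (per-mode instantiation of t4's `h8_of_s8TM`)

RH-FREE (label, line 1).  bears_on (cell rh-crit, corpus C1): route «ConnesConsaniSemilocal» item K3
`WindowSpectralBound` (stmt 19306) — the (E-a) conjunct of `CC2021_section6_enclosures`.  This leaf plugs, into the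
∃E socket `ArchCertT2.h8_of_s8TM` of `ArchKernelTier2S8Sound` (t4 g4, statement of record R138), the per-mode data
of the eight modes of K1: the identification `prolateFun n = frobEvenExt (b n)` and `t n = epsSlopeTerm (prolateFun n)`
(`ArchKernelModesIdentified`, gm-t16), the contracted coefficient enclosures `combinedLit_encloses`
(`ArchKernelTier2CombineSound`, eng-1), and the truncation bounds (i)–(v) + the allowance inequality (vi)
(`ArchKernelS8TruncationBounds`, gm-t16; `δG = δi = tinB/S`, `A = FpB/S`, `B = GsB/S`, `δo = toutB/S`,
`Kin = 24`, `Kout = koutAt n` with the zero padding of `fStd` folded away).  RESULT: `h8E_of_s8TM` — for ANY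
`s8 : ℕ → IPoly` with `s8TM hQ 6 (centre K) combinedLit = some (s8 K)` (`K < 64`; cc-iso's `s8TM_isSome` gives it for
`s8Stub`), the ∃E Taylor-model statement `∃ E, TMem S hQ E (s8 K) ∧ E = S₈∘exp on [0, log 2]` holds on every panel.
Source of the numbers: A. Connes, C. Consani, Selecta Math. 27 (2021), Prop. 5.3 / Lemma 5.4 §5 pp. 32–33 and
§6.3–6.4 p. 24 [cite: ConnesConsani2021, Prop. 5.3 / Lemma 5.4 §5 pp. 32–33 and §6.3–6.4 p. 24].  Theorems only;
nothing here is about RH; nothing here bears on the truth of RH.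
-/

noncomputable section

namespace Literature.NumberTheory.ConnesConsani2021.ArchCertT2

open Literature.Analysis.ValidatedNumerics Literature.Analysis.ValidatedNumerics.NumericsMP
open Literature.Analysis.ValidatedNumerics.PolyMP
open Literature.NumberTheory.ConnesConsani2021.ArchCertSigma (hQ sigmaTM)
open Literature.NumberTheory.ConnesConsani2021.ArchCert
open Literature.NumberTheory.LFunctions Set Finset Real
open scoped Nat

/-- Integer facts about the eight modes of record used by the glue: `koutOf n = koutAt n ∈ [24, 34]`,
`24 ≤ K_n`, `koutAt n ≤ K_n` (by `decide`). [cite: ConnesConsani2021, Prop. 5.3 / Lemma 5.4 §5 pp. 32–33 and §6.3–6.4 p. 24 (in-kernel certificate for the §6 kernel enclosure)] -/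
theorem modes_orders_ok : ∀ n < 8, koutOf n = koutAt n ∧ 24 ≤ koutOf n ∧ koutOf n ≤ 34 ∧
    24 ≤ (modes.getD n dflt).K ∧ koutAt n ≤ (modes.getD n dflt).K := by
  decide

/-- **H8E discharged** (modulo the `some`-form `h8P`, which cc-iso's `s8TM_isSome` supplies for `s8Stub`): the ∃E
Taylor-model read-back of `S₈(e^{c_K+u}) = Σ_{n<8} sonineQTerm (prolateFun n) (prolateEigen n) (e^{c_K+u})` on every
panel `K < 64`, from K1's identified modes, eng-1's contracted data and gm-t16's truncation bounds. [cite: ConnesConsani2021, Prop. 5.3 / Lemma 5.4 §5 pp. 32–33 and §6.3–6.4 p. 24 (in-kernel certificate for the §6 kernel enclosure)] -/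
theorem h8E_of_s8TM (s8 : ℕ → IPoly) (h8P : ∀ K < 64, s8TM hQ 6 (centre K) combinedLit = some (s8 K)) :
    ∀ K < 64, ∃ E : ℝ → ℝ, TMem S hQ E (s8 K) ∧
      ∀ u : ℝ, 0 ≤ cK K + u → cK K + u ≤ Real.log 2 → E u = S8 (Real.exp (cK K + u)) := by
  -- identification: critical parameters with `prolateFun n = frobEvenExt (b n)`
  obtain ⟨b, hb⟩ := ArchCert.modes_identified_mem dflt
  have hbmem : ∀ n < 8, MI.mem S (b n) (md n).chi := fun n hn ↦ (hb n hn).1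
  have hBc : ∀ n, n < 8 → frobSol₁ 1 (b n) 0 = 0 := fun n hn ↦ (hb n hn).2.1
  have hid : ∀ n, n < 8 → prolateFun n = frobEvenExt (b n) := fun n hn ↦ (hb n hn).2.2
  -- the `t`-row
  have ht : ∀ n < 8, ∀ q : MI × MI × MI × MI, modeQuantities (md n) = some q →
      MI.mem S (epsSlopeTerm (prolateFun n)) q.2.2.2 := ArchCert.mem_epsSlopeTerm_of_lt_eight dflt
  -- eng-1's contracted data
  obtain ⟨hC, hFs, hFu⟩ := combinedLit_encloses (t := fun n ↦ epsSlopeTerm (prolateFun n)) hbmem ht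
  -- per-mode tail checks
  have hT : ∀ n < 8, tailCheckMI (md n).chi (md n).K (md n).tail = true := fun n hn ↦
    (modeTailOK_spec (checks_of_mem_modes (md_mem hn)).2).1
  -- `fStd` agrees with `(k+1)·a_{k+1}` below `koutOf n`
  have hf : ∀ n < 8, ∀ k < koutOf n, fStd b n k = ((k : ℝ) + 1) * frobCoeff 1 (b n) (k + 1) := by
    intro n _ k hk
    unfold fStd; rw [if_pos hk, mul_comm]
  have hf24 : ∀ n < 8, ∀ k < 24, fStd b n k = ((k : ℝ) + 1) * frobCoeff 1 (b n) (k + 1) :=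
    fun n hn k hk ↦ hf n hn k (lt_of_lt_of_le hk (modes_orders_ok n hn).2.1)
  have hg : ∀ n i, gStd b n i = fStd b n i - 2 * (if i = 0 then 0 else fStd b n (i - 1))
      + (if i < 2 then 0 else fStd b n (i - 2)) := fun n i ↦ rfl
  refine h8_of_s8TM s8 h8P hBc hid (fun n _ ↦ rfl) hC hFs hFu
    (δG := fun n ↦ (tinB (md n) 24 : ℝ) / S) (δi := fun n ↦ (tinB (md n) 24 : ℝ) / S)
    (δo := fun n ↦ (toutB (md n) (koutAt n) : ℝ) / S) (A := fun n ↦ (FpB (md n) : ℝ) / S)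
    (B := fun n ↦ (GsB (md n) 24 : ℝ) / S) ?_ ?_ ?_ ?_ ?_ ?_
  · -- (i)
    intro n hn x hx
    exact abs_sq_mul_frobSol₁_add_gsum_le_tinB (hbmem n hn) (hT n hn) (by norm_num)
      (modes_orders_ok n hn).2.2.2.1 (hf24 n hn) (hg n) hx
  · -- (ii)
    intro n hn x hx
    exact abs_frobSol₁_add_sum_le_tinB (hbmem n hn) (hT n hn) (by norm_num)
      (modes_orders_ok n hn).2.2.2.1 (hf24 n hn) hx
  · -- (iii)
    intro n hn x hx
    exact abs_gsum_le_GsB (hbmem n hn) (by norm_num) (hf24 n hn) (hg n) hx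
  · -- (iv): fold the zero padding `koutOf n ≤ j < 34` away, then the outer truncation at `koutAt n`
    intro n hn y hy
    obtain ⟨hko, -, hk34, -, hkK⟩ := modes_orders_ok n hn
    have hpad : ∑ j ∈ range 34, fStd b n j * (1 - y) ^ j
        = ∑ j ∈ range (koutOf n), fStd b n j * (1 - y) ^ j := by
      symm
      refine Finset.sum_subset (Finset.range_subset_range.2 hk34) fun j _ hj ↦ ?_
      have hj' : ¬ j < koutOf n := fun h ↦ hj (Finset.mem_range.2 h)
      unfold fStd; rw [if_neg hj', zero_mul]
    rw [hpad, hko]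
    have hfn : ∀ k < koutAt n, fStd b n k = ((k : ℝ) + 1) * frobCoeff 1 (b n) (k + 1) := by
      rw [← hko]; exact hf n hn
    exact abs_frobSol₁_add_sum_le_toutB (hbmem n hn) (hT n hn) hkK hfn hy
  · -- (v)
    intro n hn y hy
    exact abs_frobSol₁_le_FpB (hbmem n hn) (hT n hn) ⟨by linarith [hy.1], hy.2⟩
  · -- (vi)
    exact wBound dflt ht

end Literature.NumberTheory.ConnesConsani2021.ArchCertT2

end
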